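import Mathlib.Combinatorics.SetFamily.HarrisKleitman
import Mathlib.Data.Finset.Sups
import HarnessLib
import Literature.Probability.LatticeModels.StrassenHolleyCoupling
import Summits.CriticalPhenomena.PercolationContinuityZ3.Theorems.PercNearOneGluingNoHeavyLowerTailSahiGridPatternZProfile

/-!
# Kozma–Nitzan's Question 8 at three relays — the WEIGHTED KLEITMAN STEP behind THEOREM R1-ALL
# (an upper family carries at least as much mass of a nonnegative ANTITONE set function on complements as on itself)

Support file (`--supports stmt-CriticalPhenomena-4575`, closed crux; independent mathematics on Kozma–Nitzan's Question 8,
arXiv:2401.12397 §5.5 p. 36), prover `prim-ineq-gen-6` (gen 19).  No definitions, no named facts, no sorries; standard axioms.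
Memo `run/shared/lean/prim/prim-ineq-gen-6/FINDING-G19.md` §6e (THEOREM R1-ALL: for EVERY inner type `W` of the marker — cycles through the
marker allowed — the row `t1 ≽ t5` of the 3-copy kernel has nonnegative mass on every up-set of the kernel poset).  After the reductions of the
memo ((K-c) and (K-a) for the merged-root graphs `T/S`, THEOREM A', and the poset Lemma Δ′ for virtual edges), what remains is a statement about
the a/b-copy channel-sum SET FUNCTIONS on the Boolean lattice `2^[d]` of the marker's attachment edges: for the antitone nonnegative set
function `π` (`π(S) = E_w[p(S,ζ)·C_{I(S,ζ)}]` decreases when `S` grows) and every upper family `𝒜 ⊆ 2^[d]`,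
      `Σ_{S ∈ 𝒜} π(S) ≤ Σ_{S ∈ 𝒜} π(Sᶜ)`.
Proof (memo §6e (iii)): layer cake — with `g(T) := π(Tᶜ)` (monotone, ≥ 0) the difference is `Σ_T w(T)·g(T)` for the signed weight
`w = 1_𝒜 − 1_{𝒜ᶜˢ}`, and `w` has nonnegative mass on every upper family `U` because `#(U ∩ 𝒜ᶜˢ) ≤ #(U ∩ 𝒜)` (Kleitman, then Harris:
tree lemma `SahiGridPattern.card_inter_compls_le`); conclude with the layer-cake lemma `Literature…sum_mul_nonneg_of_upperSets`.
* `PocketCert.sum_indicator_sub_compls_nonneg` — the signed weight `1_𝒜 − 1_{𝒜ᶜˢ}` is nonnegative on upper families;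
* `PocketCert.kleitmanStep_antitone` — the weighted Kleitman step displayed above.
[cite: KozmaNitzan2024, Question 8 (§5.5 p. 36)]
-/

namespace Summit.CriticalPhenomena.PercolationContinuityZ3.Theorems

namespace PocketCert

open Finset
open scoped FinsetFamily

variable {α : Type*} [DecidableEq α] [Fintype α]

/-- For upper families `𝒜, U ⊆ 2^[n]`: `Σ_{T ∈ U} (1_𝒜 − 1_{𝒜ᶜˢ})(T) ≥ 0`, i.e. `#(U ∩ 𝒜ᶜˢ) ≤ #(U ∩ 𝒜)` (Kleitman, then Harris).
[cite: KozmaNitzan2024, Question 8 (§5.5 p. 36)] -/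
theorem sum_indicator_sub_compls_nonneg {𝒜 : Finset (Finset α)} (h𝒜 : IsUpperSet (𝒜 : Set (Finset α)))
    (U : Finset (Finset α)) (hU : IsUpperSet (U : Set (Finset α))) :
    0 ≤ ∑ T ∈ U, ((if T ∈ 𝒜 then (1:ℝ) else 0) - (if T ∈ 𝒜ᶜˢ then (1:ℝ) else 0)) := by
  rw [Finset.sum_sub_distrib]
  have h1 : ∑ T ∈ U, (if T ∈ 𝒜 then (1:ℝ) else 0) = ((U ∩ 𝒜).card : ℝ) := by
    rw [← Finset.sum_filter, Finset.filter_mem_eq_inter]; simp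
  have h2 : ∑ T ∈ U, (if T ∈ 𝒜ᶜˢ then (1:ℝ) else 0) = ((U ∩ 𝒜ᶜˢ).card : ℝ) := by
    rw [← Finset.sum_filter, Finset.filter_mem_eq_inter]; simp
  rw [h1, h2]
  have h := SahiGridPattern.card_inter_compls_le hU h𝒜
  have : ((U ∩ 𝒜ᶜˢ).card : ℝ) ≤ ((U ∩ 𝒜).card : ℝ) := by exact_mod_cast h
  linarith

/-- **Weighted Kleitman step** (memo FINDING-G19 §6e (iii)): for a nonnegative ANTITONE set function `π` on `2^[n]` and an upper family `𝒜`,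
`Σ_{S∈𝒜} π(S) ≤ Σ_{S∈𝒜} π(Sᶜ)`. [cite: KozmaNitzan2024, Question 8 (§5.5 p. 36)] -/
theorem kleitmanStep_antitone (π : Finset α → ℝ) (hπ0 : ∀ S, 0 ≤ π S)
    (hπ : ∀ S T : Finset α, S ⊆ T → π T ≤ π S)
    {𝒜 : Finset (Finset α)} (h𝒜 : IsUpperSet (𝒜 : Set (Finset α))) :
    ∑ S ∈ 𝒜, π S ≤ ∑ S ∈ 𝒜, π Sᶜ := by
  classical
  -- g(T) := π(Tᶜ) is monotone and nonnegative
  set g : Finset α → ℝ := fun T => π Tᶜ with hg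
  have g0 : ∀ T, 0 ≤ g T := fun T => hπ0 _
  have gmono : Monotone g := by
    intro S T hST
    simp only [hg]
    exact hπ Tᶜ Sᶜ (compl_subset_compl.2 (by simpa using hST))
  -- the signed weight
  set w : Finset α → ℝ := fun T => (if T ∈ 𝒜 then (1:ℝ) else 0) - (if T ∈ 𝒜ᶜˢ then (1:ℝ) else 0) with hw
  have hlc := Literature.Probability.LatticeModels.sum_mul_nonneg_of_upperSets w g
    (fun U hU => sum_indicator_sub_compls_nonneg h𝒜 U hU) g0 gmono
  -- identify the two sums
  have hA : ∑ S ∈ 𝒜, π Sᶜ = ∑ T, (if T ∈ 𝒜 then (1:ℝ) else 0) * g T := by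
    rw [← Finset.sum_filter_of_ne (s := Finset.univ) (p := fun T => T ∈ 𝒜) (f := fun T => (if T ∈ 𝒜 then (1:ℝ) else 0) * g T)
      (fun T _ hT => by by_contra h; simp [h] at hT)]
    rw [Finset.filter_univ_mem]
    refine Finset.sum_congr rfl fun T hT => ?_
    simp [hT, hg]
  have hB : ∑ S ∈ 𝒜, π S = ∑ T, (if T ∈ 𝒜ᶜˢ then (1:ℝ) else 0) * g T := by
    have e1 : ∑ S ∈ 𝒜, π S = ∑ T ∈ 𝒜ᶜˢ, g T := by
      rw [show (𝒜ᶜˢ : Finset (Finset α)) = 𝒜.map ⟨compl, compl_injective⟩ from rfl, Finset.sum_map]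
      refine Finset.sum_congr rfl fun S _ => ?_
      simp [hg]
    rw [e1, ← Finset.sum_filter_of_ne (s := Finset.univ) (p := fun T => T ∈ 𝒜ᶜˢ) (f := fun T => (if T ∈ 𝒜ᶜˢ then (1:ℝ) else 0) * g T)
      (fun T _ hT => by by_contra h; simp [h] at hT)]
    rw [Finset.filter_univ_mem]
    refine Finset.sum_congr rfl fun T hT => ?_
    simp [hT]
  have hdiff : ∑ T, w T * g T = ∑ S ∈ 𝒜, π Sᶜ - ∑ S ∈ 𝒜, π S := by
    rw [hA, hB, ← Finset.sum_sub_distrib]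
    refine Finset.sum_congr rfl fun T _ => ?_
    simp only [hw]; ring
  linarith [hlc, hdiff]

end PocketCert

end Summit.CriticalPhenomena.PercolationContinuityZ3.Theorems
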